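import Summits.CriticalPhenomena.CardyFormulaZ2.Theorems.CardyBoundaryCoulombGasHalfPlaneMarkDensityLawSelfDualityParity

/-!
# Self-duality of the half-plane arc-crossing function of bond-`ℤ²`, part 5a: partners of odd faces

Support file for the crux `HalfPlaneMarkDensityLaw` (stmt-CriticalPhenomena-5661), line `Sketch`
(a-priori structure of the open stub C⁺: self-duality, Stage II — bottom-row insensitivity).
The "few boundary touches ⇒ three arms" step needs, from an isolated block of boundary touches of
a cluster inside a box, TWO closed dual arms (left and right of the block).  The combinatorial input
is this variant of the parity lemma of part 2 (`parity_core`): for a coloured set `C` strictly inside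
the box `[0,m] × [0,n]` (off the columns `x₀ ≤ 1`, the column `x₀ = m` and the row `x₁ = n`), EVERY
bottom face with a bichromatic bottom edge is joined in the bichromatic face graph
`bichromaticGraph C m n` (`PlanarDuality.lean`) to ANOTHER such bottom face
(`exists_other_odd_bottom`: handshake in its component for the auxiliary colouring `C ∨ (x₀ = 0)`,
whose only other odd face is the isolated top-left corner).  The winding number of the open arm
then tells the two partners of the extreme faces of the block apart (part 5b).
-/

noncomputable section

namespace Summit.CriticalPhenomena.CardyFormulaZ2.Cruxes.HalfPlaneMarkDensityLaw.SketchLine.SelfDual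

open Literature.Probability.Percolation Literature.Probability.LatticeModels
open MeasureTheory Filter Set SimpleGraph Finset
open Summit.CriticalPhenomena.CardyFormulaZ2.Theorems.HalfPlaneMarkDensityLaw.Negative

/-- **Every odd bottom face has a partner.**  Let `C` be a set of sites of the box `[0,m] × [0,n]`
avoiding the columns `x₀ ≤ 1`, the column `x₀ = m` and the row `x₁ = n`, and let `(k,-1)`,
`1 ≤ k ≤ m-1`, be a bottom face whose bottom edge `{(k,0),(k+1,0)}` is bichromatic.  Then there is
ANOTHER bottom face `(k',-1)`, `k' ≠ k`, `1 ≤ k' ≤ m-1`, with a bichromatic bottom edge, joined to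
`(k,-1)` in `bichromaticGraph C m n`.  [Handshake lemma in the component of `(k,-1)` for the
auxiliary colouring `C ∨ (x₀ = 0)`: its odd faces are the bottom faces with bichromatic bottom edge
and the top-left corner face, which is isolated in the left column.]
[cite: BollobasRiordan2006, Ch. 3, Lemma 1 (parity proof of "at least one")] -/
theorem exists_other_odd_bottom {C : Site 2 → Prop} {m n : ℕ}
    (hC : ∀ x, C x → 2 ≤ x 0 ∧ x 0 + 1 ≤ m ∧ x 1 + 1 ≤ n) (hn : 1 ≤ n)
    {k : ℤ} (hk1 : 1 ≤ k) (hkm : k + 1 ≤ m) (hbk : C ![k, 0] ↔ ¬ C ![k + 1, 0]) :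
    ∃ k' : ℤ, k' ≠ k ∧ 1 ≤ k' ∧ k' + 1 ≤ m ∧ (C ![k', 0] ↔ ¬ C ![k' + 1, 0]) ∧
      (bichromaticGraph C m n).Reachable ![k, -1] ![k', -1] := by
  classical
  -- the auxiliary colouring and its face graph
  set c' : Site 2 → Prop := fun x => C x ∨ x 0 = 0 with hc'
  set G := bichromaticGraph c' m n with hG
  have hL : ∀ x ∈ leftSide m n, c' x := fun x hx => Or.inr (Finset.mem_filter.1 hx).2
  have hR : ∀ x ∈ rightSide m n, ¬ c' x := by
    intro x hx
    have hx0 : x 0 = m := (Finset.mem_filter.1 hx).2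
    rintro (h | h)
    · have := (hC x h).2.1; omega
    · omega
  -- parity of the number of bichromatic neighbours of a face of the dual rectangle
  have hodd : ∀ z ∈ dualRectangle m n, Odd #((nbrs z).filter fun z' => G.Adj z z') ↔
      (z 1 = -1 ∧ (c' (z + Pi.single 1 1) ↔ ¬ c' (z + Pi.single 1 1 + Pi.single 0 1))) ∨
        (z 1 = n ∧ z 0 = 0) := by
    intro z hz
    have hzD := mem_dualRectangle_iff.1 hz
    rcases lt_trichotomy (z 1) (-1) with h | h | h
    · omega
    · rw [hG, odd_card_filter_adj_bottom hz h]
      have : ¬ ((-1 : ℤ) = n) := by omega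
      simp only [h, true_and, this, false_and, or_false]
    · rcases lt_or_ge (z 1) n with h' | h'
      · have hzn : ¬ (z 1 = n) := by omega
        have hzm : ¬ (z 1 = -1) := by omega
        simp only [hzn, hzm, false_and, or_self, iff_false, Nat.not_odd_iff_even]
        exact even_card_filter_adj_interior hz hL hR (by omega) (by omega)
      · have hzn : z 1 = n := by omega
        rw [hG, odd_card_filter_adj_top hz hzn]
        have hzm : ¬ ((n : ℤ) = -1) := by omega
        have hCz : ¬ C z := fun hc => by have := (hC z hc).2.2; omega
        have hCz' : ¬ C (z + Pi.single 0 1) := fun hc => by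
          have := (hC _ hc).2.2; simp at this; omega
        have h0 : ¬ ((z + Pi.single 0 1 : Site 2) 0 = 0) := by simp; omega
        simp only [hzn, hzm, false_and, false_or, true_and, hc', hCz, hCz', h0, or_false, false_or,
          not_false_eq_true, iff_true]
  -- the left column is closed under adjacency
  have hcol : ∀ z z' : Site 2, G.Adj z z' → z 0 = 0 → z' 0 = 0 := by
    intro z z' h hz0
    obtain ⟨hadj, hzD, hz'D, hB⟩ := h
    have hz'D' := mem_dualRectangle_iff.1 hz'D
    rcases stepKind_of_adj hadj with ⟨h0, h1⟩ | ⟨h0, h1⟩ | ⟨h1, h0⟩ | ⟨h1, h0⟩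
    · exfalso
      have hzz' : z' = z + Pi.single 0 1 := by simp [Site.eq_iff_two, h0, h1]
      obtain ⟨hlo, hhi, hc⟩ := hB
      rw [hzz', sepLo_add_e0, sepHi_add_e0] at hc
      have e1 : ¬ c' (z + Pi.single 0 1) := by
        rintro (h | h)
        · have := (hC _ h).1; simp at this; omega
        · simp at h; omega
      have e2 : ¬ c' (z + Pi.single 0 1 + Pi.single 1 1) := by
        rintro (h | h)
        · have := (hC _ h).1; simp at this; omega
        · simp at h; omega
      tauto
    · omega
    · omega
    · omega
  have hcolR : ∀ z z' : Site 2, G.Reachable z z' → z 0 = 0 → z' 0 = 0 := by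
    intro z z' ⟨W⟩
    induction W with
    | nil => exact id
    | cons h W ih => exact fun hz => ih (hcol _ _ h hz)
  -- the face `(k,-1)`, its component, and the faces of the dual rectangle in it
  set f₀ : Site 2 := ![k, -1] with hf₀
  have hf₀D : f₀ ∈ dualRectangle m n := by rw [mem_dualRectangle_iff]; simp [hf₀]; omega
  set cpt := G.connectedComponentMk f₀ with hcpt
  have hKcol : ∀ z : Site 2, G.connectedComponentMk z = cpt → z 0 ≠ 0 := by
    intro z hz h0
    have hreach : G.Reachable z f₀ := SimpleGraph.ConnectedComponent.exact hz
    have := hcolR _ _ hreach h0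
    simp [hf₀] at this; omega
  set Kf : Finset (Site 2) := (dualRectangle m n).filter fun z => G.connectedComponentMk z = cpt with hKf
  -- handshake in the induced graph
  set H : SimpleGraph ↥(↑Kf : Set (Site 2)) := G.induce ↑Kf with hH
  have hdeg : ∀ w : ↥(↑Kf : Set (Site 2)), H.degree w = #((nbrs (w : Site 2)).filter fun z' => G.Adj w z') := by
    intro w
    rw [← SimpleGraph.card_neighborFinset_eq_degree, ← Finset.card_map (Function.Embedding.subtype _)]
    congr 1
    ext z'
    simp only [Finset.mem_map, SimpleGraph.mem_neighborFinset, Function.Embedding.coe_subtype,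
      Finset.mem_filter, Subtype.exists, exists_and_right, exists_eq_right, hH, SimpleGraph.comap_adj,
      SimpleGraph.induce]
    constructor
    · rintro ⟨hz', h⟩
      exact ⟨mem_nbrs_of_adj h.1, h⟩
    · rintro ⟨-, h⟩
      refine ⟨?_, h⟩
      rw [Finset.mem_coe, hKf, Finset.mem_filter]
      refine ⟨h.2.2.1, ?_⟩
      rw [← (Finset.mem_filter.1 w.2).2]
      exact SimpleGraph.ConnectedComponent.sound h.symm.reachable
  have hand := H.even_card_odd_degree_vertices
  set P : Site 2 → Prop := fun z => z 1 = -1 ∧ (c' (z + Pi.single 1 1) ↔ ¬ c' (z + Pi.single 1 1 + Pi.single 0 1)) with hP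
  have hcardP : #(Finset.univ.filter fun w : ↥(↑Kf : Set (Site 2)) => Odd (H.degree w)) = #(Kf.filter P) := by
    refine Finset.card_bij (fun w _ => (w : Site 2)) ?_ ?_ ?_
    · intro w hw
      have hwK : (w : Site 2) ∈ Kf := w.2
      rw [Finset.mem_filter] at hw ⊢
      refine ⟨hwK, ?_⟩
      have hwD : (w : Site 2) ∈ dualRectangle m n := (Finset.mem_filter.1 hwK).1
      have h := (hodd _ hwD).1 (by rw [← hdeg]; exact hw.2)
      rcases h with h | h
      · exact h
      · exact absurd h.2 (hKcol _ (Finset.mem_filter.1 hwK).2)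
    · intro w₁ _ w₂ _ h
      exact Subtype.ext h
    · intro z hz
      rw [Finset.mem_filter] at hz
      refine ⟨⟨z, Finset.mem_coe.2 hz.1⟩, ?_, rfl⟩
      rw [Finset.mem_filter]
      refine ⟨Finset.mem_univ _, ?_⟩
      rw [hdeg]
      exact (hodd _ (Finset.mem_filter.1 hz.1).1).2 (Or.inl hz.2)
  rw [hcardP] at hand
  -- bottom bichromatic edges, translated between `C` and `c'` (both endpoints off the left column)
  have hPiff : ∀ j : ℤ, 1 ≤ j → (P ![j, -1] ↔ (C ![j, 0] ↔ ¬ C ![j + 1, 0])) := by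
    intro j hj
    have e1 : (![j, -1] : Site 2) + Pi.single 1 1 = ![j, 0] := by ext i; fin_cases i <;> simp
    have e2 : (![j, 0] : Site 2) + Pi.single 0 1 = ![j + 1, 0] := by ext i; fin_cases i <;> simp
    have n1 : ¬ ((![j, 0] : Site 2) 0 = 0) := by simp; omega
    have n2 : ¬ ((![j + 1, 0] : Site 2) 0 = 0) := by simp; omega
    simp only [hP, e1, e2]
    constructor
    · rintro ⟨-, h⟩; exact iff_not_of_or_iff n1 n2 h
    · intro h
      refine ⟨by simp, ?_⟩
      simp only [hc', n1, n2, or_false]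
      exact h
  -- `f₀` is an odd face of its component
  have hf₀P : f₀ ∈ Kf.filter P := by
    rw [Finset.mem_filter, hKf, Finset.mem_filter]
    exact ⟨⟨hf₀D, rfl⟩, (hPiff k hk1).2 hbk⟩
  -- so there is another one
  obtain ⟨z, hz, hzne⟩ : ∃ z ∈ Kf.filter P, z ≠ f₀ := by
    by_contra hall
    push Not at hall
    have hsub : Kf.filter P = {f₀} :=
      Finset.eq_singleton_iff_unique_mem.2 ⟨hf₀P, fun z hz => hall z hz⟩
    rw [hsub, Finset.card_singleton] at hand
    exact absurd hand (by decide)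
  rw [Finset.mem_filter, hKf, Finset.mem_filter] at hz
  obtain ⟨⟨hzD, hzc⟩, hzP⟩ := hz
  have hzD' := mem_dualRectangle_iff.1 hzD
  have hz1 : z 1 = -1 := hzP.1
  have hz0 : z 0 ≠ 0 := hKcol z hzc
  set k' := z 0 with hk'
  have hzk : z = ![k', -1] := by ext i; fin_cases i <;> simp [hk', hz1]
  refine ⟨k', ?_, by omega, by omega, ?_, ?_⟩
  · intro heq
    exact hzne (by rw [hzk, heq])
  · rw [hzk] at hzP
    exact (hPiff k' (by omega)).1 hzP
  · -- the walk, pushed to the face graph of `C`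
    have hreach : G.Reachable f₀ z := SimpleGraph.ConnectedComponent.exact hzc.symm
    rw [hzk] at hreach
    obtain ⟨W⟩ := hreach
    have hsupp : ∀ {x y : Site 2} (W' : G.Walk x y), x ∈ dualRectangle m n →
        ∀ w ∈ W'.support, w ∈ dualRectangle m n := by
      intro x y W' hx
      induction W' with
      | nil => intro w hw; rw [Walk.support_nil, List.mem_singleton] at hw; rw [hw]; exact hx
      | cons h W' ih =>
        intro w hw
        rw [Walk.support_cons, List.mem_cons] at hw
        rcases hw with rfl | hw
        · exact hx
        · exact ih h.2.2.1 w hw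
    refine reachable_of_walk_or W fun w hw => ?_
    have hreachw : G.Reachable f₀ w := ⟨W.takeUntil w hw⟩
    have hwc : G.connectedComponentMk w = cpt := (SimpleGraph.ConnectedComponent.sound hreachw).symm
    have hw0 : w 0 ≠ 0 := hKcol w hwc
    have hwD : 0 ≤ w 0 := (mem_dualRectangle_iff.1 (hsupp W hf₀D w hw)).1
    omega

/-- **Every odd bottom face has a partner, registered form** of `exists_other_odd_bottom`.
[cite: BollobasRiordan2006, Ch. 3, Lemma 1 (parity proof of "at least one")] -/
theorem odd_bottom_partner : ∀ {C : Site 2 → Prop} {m n : ℕ}, (∀ x, C x → 2 ≤ x 0 ∧ x 0 + 1 ≤ m ∧ x 1 + 1 ≤ n) → 1 ≤ n → ∀ {k : ℤ}, 1 ≤ k → k + 1 ≤ m → (C ![k, 0] ↔ ¬ C ![k + 1, 0]) → ∃ k' : ℤ, k' ≠ k ∧ 1 ≤ k' ∧ k' + 1 ≤ m ∧ (C ![k', 0] ↔ ¬ C ![k' + 1, 0]) ∧ (bichromaticGraph C m n).Reachable ![k, -1] ![k', -1] :=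
  fun hC hn _ hk1 hkm hbk => exists_other_odd_bottom hC hn hk1 hkm hbk

end Summit.CriticalPhenomena.CardyFormulaZ2.Cruxes.HalfPlaneMarkDensityLaw.SketchLine.SelfDual
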